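import Literature.Computability.Complexity.HardcoreInapproximabilityCyclesJoint
import HarnessLib

/-!
# Sly (2010), Theorem 3.10 — cycle counts of the random bipartite multigraph

Small-subgraph-conditioning bookkeeping for the configuration-type model `G̃(n + m', q)` of
[Sly2010, §3.2]: the number `X_{2j}` of (unrooted, unoriented) present cycles of length `2j`
(`slyNumCycles`), the orbit identity `R_{2j} = 2j · X_{2j}` relating it to the rooted oriented
count `slyRootedCycles`, and the falling-factorial identity
`DT_m = (2j)^m · m! · C(X_{2j}, m)` for the distinct-tuple counts `slyDistinctTuples` whose
factorial moments are computed in `HardcoreInapproximabilityCyclesJoint`.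

## References
* [Sly2010] A. Sly, *Computational transition at the uniqueness threshold*, FOCS 2010,
  arXiv:1005.5584, §3.2 and the proof of Theorem 3.10.
* [MosselWeitzWormald2008] E. Mossel, D. Weitz, N. Wormald, *On the hardness of sampling
  independent sets beyond the tree threshold*, PTRF 143 (2009), §4 (small subgraph conditioning).
-/

namespace Literature.Computability.Complexity

open Finset Nat

section OrbitCount

variable {n m' q j : ℕ}

open scoped Classical in
/-- **The number of present cycles of length `2j`** (unrooted, unoriented): the number of orbit
classes of present rooted oriented cycles under the dihedral re-rooting action. [cite: Sly2010, §3.2 (the cycle counts `X_i`)] -/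
noncomputable def slyNumCycles (n m' q j : ℕ) (σ : Fin q → Equiv.Perm (Fin (n + m'))) (τ : Equiv.Perm (Fin n)) : ℕ :=
  ((univ.filter fun C : SlyWCycle n q j => C.Present σ τ).image SlyWCycle.reps).card

open scoped Classical in
/-- **Rooted cycles come in orbits of size `2j`**: `R_{2j} = 2j · X_{2j}`. [folklore] -/
theorem slyRootedCycles_eq (hj : 0 < j) (σ : Fin q → Equiv.Perm (Fin (n + m'))) (τ : Equiv.Perm (Fin n)) :
    slyRootedCycles n m' q j σ τ = 2 * j * slyNumCycles n m' q j σ τ := by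
  unfold slyRootedCycles slyNumCycles
  set P := (univ.filter fun C : SlyWCycle n q j => C.Present σ τ) with hP
  -- `P` is the disjoint union of its orbit classes
  have hcover : P = (P.image SlyWCycle.reps).biUnion id := by
    ext C
    simp only [Finset.mem_biUnion, Finset.mem_image, id, hP, Finset.mem_filter, Finset.mem_univ, true_and]
    constructor
    · intro hC
      exact ⟨C.reps, ⟨C, hC, rfl⟩, SlyWCycle.self_mem_reps hj C⟩
    · rintro ⟨K, ⟨D, hD, rfl⟩, hCK⟩
      exact (SlyWCycle.present_of_mem_reps hCK σ τ).mpr hD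
  have hdisj : ((P.image SlyWCycle.reps : Finset (Finset (SlyWCycle n q j))) : Set (Finset (SlyWCycle n q j))).PairwiseDisjoint id := by
    intro K hK K' hK' hne
    rw [Finset.mem_coe, Finset.mem_image] at hK hK'
    obtain ⟨D, -, rfl⟩ := hK
    obtain ⟨D', -, rfl⟩ := hK'
    rw [Function.onFun, id, id, Finset.disjoint_left]
    intro C hC hC'
    apply hne
    rw [← SlyWCycle.reps_eq_of_mem_reps hj hC, ← SlyWCycle.reps_eq_of_mem_reps hj hC']
  conv_lhs => rw [hcover]
  rw [Finset.card_biUnion hdisj, Finset.sum_const_nat (m := 2 * j) fun K hK => ?_]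
  · ring
  · rw [Finset.mem_image] at hK
    obtain ⟨D, -, rfl⟩ := hK
    exact SlyWCycle.card_reps hj D

/-- **The distinct-tuple counts are falling factorials of the cycle count**:
`DT_m = (2j)^m · m! · C(X_{2j}, m)`. [folklore] -/
theorem slyDistinctTuples_eq_choose (hj : 0 < j) (m : ℕ) (σ : Fin q → Equiv.Perm (Fin (n + m'))) (τ : Equiv.Perm (Fin n)) :
    slyDistinctTuples n m' q j m σ τ = (2 * j) ^ m * (m ! * (slyNumCycles n m' q j σ τ).choose m) := by
  rw [slyDistinctTuples_eq_prod hj, slyRootedCycles_eq hj, ← Nat.descFactorial_eq_factorial_mul_choose,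
    Nat.descFactorial_eq_prod_range, Finset.pow_eq_prod_const, ← Finset.prod_mul_distrib]
  refine Finset.prod_congr rfl fun k _ => ?_
  rw [Nat.mul_sub]

end OrbitCount

end Literature.Computability.Complexity
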